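import Literature.Probability.Percolation.TriCrossingSandwich
import HarnessLib

/-!
# A dual cross-cut far from the crossed arcs blocks open crossings of `Ω_δ` (bond `ℤ²`)

Topic: Probability / Percolation. Companion to `BoxCrossingUpperBound.lean`
(`not_mem_discreteCrossing_of_crosscut`) and to the `𝕋` sandwich file `TriCrossingSandwich.lean`
(Bollobás–Riordan, *Percolation* (2006), Ch. 7, Claim 19 p. 192 and remark p. 195: a closed
crossing of the shorter, fatter comparison domain "prevents a crossing of `D₄` from `A₂` to
`A₄`"; Grimmett, *Probability on Graphs* (2018), §5.7 for the duality step on `ℤ²`).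

* `not_mem_discreteCrossing_of_far_crosscut`: the blocking step of the RSW upper bound /
  sandwich for H21's discretisation `discreteCrossing` on bond `ℤ²`, in the form needed when the
  dual cross-cut `Λ` is supplied by an arbitrary dual-open lattice path rather than by a chain of
  circuits: instead of the trichotomy "near `b'` / near `d'` / deep in `Ω`" of
  `not_mem_discreteCrossing_of_crosscut` we assume that every point of `Λ` is farther than `2δ`
  from `arc 0` and from `arc 2`. An open `Ω_δ`-path from the discrete arc of `arc 0` to that of
  `arc 2`, extended along lattice edges to its first frontier points
  (`exists_frontier_exit_of_mem_meshBoundary`), joins the two boundary arcs cut off by `Λ`, hence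
  meets `Λ` (Newman 1939, Ch. V §11, `Newman1939_crosscut_holds` via
  `JordanDomain.inter_nonempty_of_crosscut`); on the lattice part this contradicts
  `disjoint_walkTrace_image_edgeTrace` (an open primal edge does not cross a dual-open dual edge),
  and the two extensions stay within `2δ` of `arc 0`, `arc 2`.
* Planar-point forms of the step classification of `TriCrossingSandwich.lean` (`NearOut`,
  `segment_subset_or_nearOut`, `NearOut.exists_exit`, `NearOut.not_nearOut`), stated for a
  segment `[p, q]` of length `≤ δ` so that they apply verbatim to any embedded lattice (here: the
  planar dual lattice `δ (ℤ² + (½, ½))`, positions `dualScale δ`):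
  `false_of_infDist_le_of_infDist_le`, `segment_subset_or_exists_near`,
  `exists_exit_of_exists_near`.

## References
* B. Bollobás, O. Riordan, *Percolation*, CUP (2006), Ch. 7 Claim 19 p. 192, remark p. 195
  [BollobasRiordan2006].
* G. Grimmett, *Probability on Graphs*, 2nd ed. (2018), §5.7 p. 176 [Grimmett2018].
* M. H. A. Newman, *Elements of the topology of plane sets of points* (1939), Ch. V §11.
-/

namespace Literature.Probability.Percolation

open Set Metric LatticeModels Literature.Topology.PlaneTopology
  Literature.Probability.RandomPlanarGeometry

noncomputable section

/-! ### Blocking: a dual cross-cut far from `arc 0 ∪ arc 2` excludes open crossings -/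

/-- **A dual-open cross-cut at distance `> 2δ` from `arc 0 ∪ arc 2` blocks open crossings**
(variant of `not_mem_discreteCrossing_of_crosscut`; Bollobás–Riordan 2006, Ch. 7 Claim 19
(second part) with the remark p. 195, Grimmett 2018 §5.7). Let `Λ` be a cross-cut of the
conformal rectangle `R` from `boundary s` to `boundary t` (`s < t < s + 1`) every point of
which lies on the planar dual edge `δ (e + (½, ½))` of an edge `e` open in `dualConfig ω` and
is farther than `2δ` from `arc 0` and from `arc 2`. If frontier points within `2δ` of `arc 0`
have parameters in `(t, s + 1)`, frontier points within `2δ` of `arc 2` have parameters in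
`(s, t)`, and the two discrete arcs are disjoint, then there is no open path of `Ω_δ` from the
discrete arc of `arc 0` to that of `arc 2`.
[cite: BollobasRiordan2006, Ch. 7 Claim 19 p. 192 and remark p. 195] -/
theorem not_mem_discreteCrossing_of_far_crosscut (R : ConformalRectangle)
    {Λ : Set ℂ} {s t : ℝ} (hst : s < t) (hts : t < s + 1)
    (hΛ : R.IsCrosscut Λ (R.boundary s) (R.boundary t))
    {δ : ℝ} (hδ : 0 < δ) {ω : BondConfig (Site 2)}
    (hedge : ∀ z ∈ Λ, ∃ e ∈ dualConfig ω, z ∈ dualScale δ '' edgeTrace e)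
    (hfar : ∀ z ∈ Λ, 2 * δ < infDist z (R.arc 0) ∧ 2 * δ < infDist z (R.arc 2))
    (H0 : ∀ f ∈ frontier R.carrier, infDist f (R.arc 0) ≤ 2 * δ →
      ∃ u ∈ Ioo t (s + 1), f = R.boundary u)
    (H2 : ∀ f ∈ frontier R.carrier, infDist f (R.arc 2) ≤ 2 * δ →
      ∃ u ∈ Ioo s t, f = R.boundary u)
    (hdisj : discreteArc R.carrier δ (R.arc 0) ∩ discreteArc R.carrier δ (R.arc 2) = ∅) :
    ω ∉ discreteCrossing R.carrier δ (R.arc 0) (R.arc 2) := by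
  rintro ⟨x, hx, y, hy, hreach⟩
  obtain ⟨π, hπω, hπcl⟩ := exists_walk_of_reachable_openGraph_inf hreach
  have hxy : x ≠ y := by
    rintro rfl
    have : x ∈ discreteArc R.carrier δ (R.arc 0) ∩ discreteArc R.carrier δ (R.arc 2) := ⟨hx, hy⟩
    rw [hdisj] at this
    exact this
  have hπn : ¬ π.Nil := fun h => hxy h.eq
  -- the two frontier exits of the open crossing
  obtain ⟨x', fx, hxx', hfxfr, hfxseg, hfxcl⟩ :=
    exists_frontier_exit_of_mem_meshBoundary R.isOpen hx.1
  obtain ⟨y', fy, hyy', hfyfr, hfyseg, hfycl⟩ :=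
    exists_frontier_exit_of_mem_meshBoundary R.isOpen hy.1
  have hδabs : |δ| = δ := abs_of_pos hδ
  have hx0 : infDist (meshPoint δ x) (R.arc 0) ≤ δ := by
    have := infDist_le_of_mem_discreteArc R.isOpen hx; rwa [hδabs] at this
  have hy2 : infDist (meshPoint δ y) (R.arc 2) ≤ δ := by
    have := infDist_le_of_mem_discreteArc R.isOpen hy; rwa [hδabs] at this
  have hsegx0 : ∀ z ∈ segment ℝ (meshPoint δ x) fx, infDist z (R.arc 0) ≤ 2 * δ := fun z hz => by
    have h1 := dist_le_of_mem_segment_of_mem_segment hxx' hfxseg hz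
    rw [hδabs] at h1
    linarith [infDist_le_infDist_add_dist (s := R.arc 0) (x := z) (y := meshPoint δ x)]
  have hsegy2 : ∀ z ∈ segment ℝ (meshPoint δ y) fy, infDist z (R.arc 2) ≤ 2 * δ := fun z hz => by
    have h1 := dist_le_of_mem_segment_of_mem_segment hyy' hfyseg hz
    rw [hδabs] at h1
    linarith [infDist_le_infDist_add_dist (s := R.arc 2) (x := z) (y := meshPoint δ y)]
  obtain ⟨u', hu', hfxu⟩ := H0 fx hfxfr (hsegx0 fx (right_mem_segment ℝ _ _))
  obtain ⟨u, hu, hfyu⟩ := H2 fy hfyfr (hsegy2 fy (right_mem_segment ℝ _ _))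
  -- the connected set `P ⊆ Ω̄` joining the two arcs cut off by `Λ`
  set P : Set ℂ := (meshTrace δ π ∪ segment ℝ (meshPoint δ x) fx) ∪ segment ℝ (meshPoint δ y) fy
    with hP
  have hxM : meshPoint δ x ∈ meshTrace δ π :=
    meshPoint_mem_meshTrace_of_mem_support hπn π.start_mem_support
  have hyM : meshPoint δ y ∈ meshTrace δ π :=
    meshPoint_mem_meshTrace_of_mem_support hπn π.end_mem_support
  have hPpre : IsPreconnected P :=
    ((isPreconnected_meshTrace δ π).union (meshPoint δ x) hxM (left_mem_segment ℝ _ _)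
      (convex_segment _ _).isPreconnected).union (meshPoint δ y) (Or.inl hyM)
      (left_mem_segment ℝ _ _) (convex_segment _ _).isPreconnected
  have hPcl : P ⊆ closure R.carrier := by
    rintro z ((hz | hz) | hz)
    · exact hπcl hz
    · exact hfxcl hz
    · exact hfycl hz
  have hfyP : R.boundary u ∈ P := by
    rw [← hfyu]; exact Or.inr (right_mem_segment ℝ _ _)
  have hfxP : R.boundary u' ∈ P := by
    rw [← hfxu]; exact Or.inl (Or.inr (right_mem_segment ℝ _ _))
  obtain ⟨z, hzP, hzΛ⟩ := R.toJordanDomain.inter_nonempty_of_crosscut Newman1939_crosscut_holds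
    hst hts hΛ hPpre hPcl hu hfyP hu' hfxP
  rcases hzP with ((hz | hz) | hz)
  · -- on the open path: a primal open edge would cross a dual-open dual edge
    obtain ⟨e, he, hze⟩ := hedge z hzΛ
    obtain ⟨e', he', z₀, hz₀, rfl⟩ := mem_meshTrace_iff.1 hz
    rw [image_dualScale] at hze
    obtain ⟨_, ⟨q, hq, rfl⟩, hqz⟩ := hze
    have hz₀q : z₀ = q + dualOffset := by
      have h1 : (δ : ℂ) * (q + dualOffset) = (δ : ℂ) * z₀ := by
        rw [← meshScale_apply, ← meshScale_apply δ z₀, ← hqz, meshScale_apply, meshScale_apply]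
        ring
      exact (mul_left_cancel₀ (by exact_mod_cast hδ.ne') h1).symm
    exact Set.disjoint_left.1 (disjoint_walkTrace_image_edgeTrace hπω he)
      (mem_walkTrace_iff.2 ⟨e', he', hz₀⟩) ⟨q, hq, hz₀q.symm⟩
  · linarith [(hfar z hzΛ).1, hsegx0 z hz]
  · linarith [(hfar z hzΛ).2, hsegy2 z hz]

/-! ### Steps of an embedded lattice path relative to a planar domain (planar-point form) -/

/-- **Outside steps near two far-apart sets exclude each other** (planar-point form of
`NearOut.not_nearOut`): two points at distance `≤ δ` cannot be within `t` of `A` and of `B`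
respectively if `dist(A, B) > 2t + 2δ`. [folklore] -/
theorem false_of_infDist_le_of_infDist_le {A B : Set ℂ} {t δ : ℝ} (hδ : 0 < δ) (hA : A.Nonempty)
    (hB : B.Nonempty) (hAB : ∀ a ∈ A, ∀ b ∈ B, 2 * t + 2 * δ < dist a b) {z z' : ℂ}
    (hzz' : dist z z' ≤ δ) (hzA : infDist z A ≤ t) (hz'B : infDist z' B ≤ t) : False := by
  obtain ⟨a, ha, hza⟩ := (infDist_lt_iff hA).1 (show infDist z A < t + δ / 2 by linarith)
  obtain ⟨b, hb, hz'b⟩ := (infDist_lt_iff hB).1 (show infDist z' B < t + δ / 2 by linarith)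
  linarith [hAB a ha b hb, dist_triangle4 a z z' b, dist_comm z a]

/-- **Classification of a step** `[p, q]` of length `≤ δ` relative to an open set `Ω` with
`frontier Ω ⊆ A ∪ B ∪ C ∪ E` (planar-point form of `segment_subset_or_nearOut`): if `p ∉ Ω`
forces `p` to be within `t` of `A` or of `B`, and `p ∈ Ω` forces `p` to be farther than `δ` from
`C` and from `E`, then `[p, q] ⊆ Ω`, or `[p, q]` carries a point off `Ω` within `t` of `A`, or
one within `t` of `B` (a frontier point on `[p, q]`, `exists_mem_segment_frontier`, is within
`δ` of `p`, hence on `A ∪ B`). [folklore] -/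
theorem segment_subset_or_exists_near {Ω A B C E : Set ℂ} (hΩ : IsOpen Ω)
    (hfr : frontier Ω ⊆ (A ∪ B) ∪ (C ∪ E)) {δ t : ℝ} (ht : 0 ≤ t) {p q : ℂ} (hpq : dist p q ≤ δ)
    (hout : p ∉ Ω → infDist p A ≤ t ∨ infDist p B ≤ t)
    (hin : p ∈ Ω → δ < infDist p C ∧ δ < infDist p E) :
    segment ℝ p q ⊆ Ω ∨ (∃ z ∈ segment ℝ p q, z ∉ Ω ∧ infDist z A ≤ t) ∨
      (∃ z ∈ segment ℝ p q, z ∉ Ω ∧ infDist z B ≤ t) := by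
  by_cases hp : p ∈ Ω
  · by_cases hseg : segment ℝ p q ⊆ Ω
    · exact Or.inl hseg
    · right
      obtain ⟨f, hf, hff⟩ := exists_mem_segment_frontier hΩ hp hseg
      have hfΩ : f ∉ Ω := fun h => by
        rw [hΩ.frontier_eq] at hff
        exact hff.2 h
      have hfd : dist p f ≤ δ :=
        (dist_le_dist_of_mem_segment (left_mem_segment ℝ p q) hf).trans hpq
      obtain ⟨hC, hE⟩ := hin hp
      rcases hfr hff with (hfA | hfB) | (hfC | hfE)
      · exact Or.inl ⟨f, hf, hfΩ, by rw [infDist_zero_of_mem hfA]; exact ht⟩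
      · exact Or.inr ⟨f, hf, hfΩ, by rw [infDist_zero_of_mem hfB]; exact ht⟩
      · exact absurd ((infDist_le_dist_of_mem hfC).trans hfd) (not_le.2 hC)
      · exact absurd ((infDist_le_dist_of_mem hfE).trans hfd) (not_le.2 hE)
  · right
    rcases hout hp with h | h
    · exact Or.inl ⟨p, left_mem_segment ℝ _ _, hp, h⟩
    · exact Or.inr ⟨p, left_mem_segment ℝ _ _, hp, h⟩

/-- **First exit of a step that leaves `Ω` near `A`** (planar-point form of
`NearOut.exists_exit`). If `[p, q]` (`dist p q ≤ δ`, `p ∈ Ω`, `p` farther than `δ` from `C`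
and `E`) carries a point off `Ω` within `t` of `A`, where `frontier Ω ⊆ A ∪ B ∪ C ∪ E` and
`dist(A, B) > 2t + 2δ`, then the first exit point `f = p + s (q - p)` (`0 < s ≤ 1`) of `[p, q]`
from `Ω` is a frontier point on `A` within `δ` of `p`, and `[p, f) ⊆ Ω`. [folklore] -/
theorem exists_exit_of_exists_near {Ω A B C E : Set ℂ} (hΩ : IsOpen Ω)
    (hfr : frontier Ω ⊆ (A ∪ B) ∪ (C ∪ E)) (hA : A.Nonempty) {δ t : ℝ} (hδ : 0 < δ)
    (hAB : ∀ a ∈ A, ∀ b ∈ B, 2 * t + 2 * δ < dist a b) {p q : ℂ} (hpq : dist p q ≤ δ)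
    {z : ℂ} (hz : z ∈ segment ℝ p q) (hzΩ : z ∉ Ω) (hzA : infDist z A ≤ t) (hpΩ : p ∈ Ω)
    (hin : δ < infDist p C ∧ δ < infDist p E) :
    ∃ (s : ℝ) (f : ℂ), 0 < s ∧ s ≤ 1 ∧ f = p + s • (q - p) ∧ f ∈ frontier Ω ∧ f ∉ Ω ∧ f ∈ A ∧
      dist p f ≤ δ ∧ (∀ s' : ℝ, 0 ≤ s' → s' < s → p + s' • (q - p) ∈ Ω) := by
  have hseg : ¬ segment ℝ p q ⊆ Ω := fun hs => hzΩ (hs hz)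
  obtain ⟨s, hs0, hs1, hffr, hfΩ, hbefore⟩ := exists_first_exit hΩ hpΩ hseg
  have hfseg : p + s • (q - p) ∈ segment ℝ p q := add_smul_sub_mem_segment hs0.le hs1
  have hfd : dist p (p + s • (q - p)) ≤ δ :=
    (dist_le_dist_of_mem_segment (left_mem_segment ℝ p q) hfseg).trans hpq
  have hzf : dist z (p + s • (q - p)) ≤ δ := (dist_le_dist_of_mem_segment hz hfseg).trans hpq
  refine ⟨s, _, hs0, hs1, rfl, hffr, hfΩ, ?_, hfd, hbefore⟩
  rcases hfr hffr with (hfA | hfB) | (hfC | hfE)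
  · exact hfA
  · exfalso
    obtain ⟨a, ha, hza⟩ := (infDist_lt_iff hA).1 (show infDist z A < t + δ / 2 by linarith)
    have := hAB a ha _ hfB
    have ht : 0 ≤ t := le_trans infDist_nonneg hzA
    linarith [dist_triangle a z (p + s • (q - p)), dist_comm a z]
  · exact absurd ((infDist_le_dist_of_mem hfC).trans hfd) (not_le.2 hin.1)
  · exact absurd ((infDist_le_dist_of_mem hfE).trans hfd) (not_le.2 hin.2)

end

end Literature.Probability.Percolation
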